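import Summits.PneNP.PneNP.Theorems.RamseyUncertifiableResolutionUncertaintyPinMonotone

/-!
# PIN LOSS: what every short dag-like refutation of the unary clique CNF must do — item stmt-PneNP-9816
# `RamseyUncertifiable.ResolutionUncertainty` (support)

A quantitative form of the pin-monotone theorem, valid for EVERY resolution refutation `π` of `Clique(G, k)` (dag-like,
no structural hypothesis). For a clique `Q` let `C⋆(Q)` be the clause of the last non-initial line of Delayer `Q`'s
walk (`TreeLike.lastLine`) and `X(Q) ⊆ Q` the set of vertices of `Q` whose pin variable occurs negatively in `C⋆(Q)`
(always `X(Q) ⊆ Q`: `decode_lastLine_subset`). The PIN LOSS of `Q` is `|Q| - |X(Q)|`: the number of pins of `Q` that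
the refutation has DROPPED (into non-initial premises) between their acquisition and the final axiom.

`card_filter_pinLoss_le`: for all `t, d`, the number of `t`-cliques `Q` with pin loss `≤ d` is at most
`|π| · Σ_{e ≤ d} C(n, e)` — the map `Q ↦ (lastLine Q, Q ∖ X(Q))` is injective.

So a refutation of length `S` must inflict pin loss `> d` on all but `S·Σ_{e≤d} C(n,e)` of the `t`-cliques; with
`#t-cliques = n^{Ω(log n)}` (2-Ramsey graphs at `t = Θ(log n)`) any refutation of length `n^{o(log n)}` drops
`Ω(log n)` pins of almost every clique along its walk: the open dag-like problem is exactly the power of pin dropping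
(parking), in this precise counting sense. Pin-monotone refutations have pin loss `0` for every `Q`
(`TreeLike.decode_lastLine`), recovering `pinMonotone_cliqueCNF_length_ge_card_cliqueFinset`.
-/

set_option linter.dupNamespace false

namespace Summit.PneNP.PneNP.Theorems.RamseyUncertifiableResolutionUncertainty

open Literature.Computability.Complexity Literature.Computability.MetaComplexity
open Summit.PneNP.PneNP.Theorems.RegularResolutionRung.Negative (cliqueCNF)

namespace TreeLike

section PinLoss

variable {n k : ℕ} (G : SimpleGraph (Fin n)) [DecidableRel G.Adj] {π : List (ResLine ℕ)} {r : ℕ}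
  (hπ : IsResDerivation (cliqueCNF n k fun u v => decide (G.Adj u v)) π) (hr : r < π.length)
include hπ hr

/-- **The shown pins are vertices of `Q`** (no structural hypothesis on `π`): the negative literals of the clause at
`lastLine Q`, read modulo `n`, lie in `Q`. -/
theorem decode_lastLine_subset (hroot : (π[r]'hr).clause = ∅) (Q : Finset (Fin n)) :
    (((π[lastLine n k π r Q]'(run_fst_lt _ hπ hr _)).clause.filter fun l => l.2 = false).image
        fun l => l.1 % n) ⊆ Q.image Fin.val := by
  classical
  intro x hx
  simp only [Finset.mem_image, Finset.mem_filter] at hx ⊢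
  obtain ⟨l, ⟨hl, hl2⟩, rfl⟩ := hx
  have hf := run_falsifies (answer n k Q) hπ hr hroot (arrival n k π r Q - 1) l hl
  rw [hl2] at hf
  obtain ⟨i, -, v, hv, hvQ⟩ := run_true_form (r := r) (π := π) Q _ hf
  refine ⟨v, hvQ, ?_⟩
  rw [hv, Nat.add_mod, Nat.mul_mod_left, Nat.zero_add, Nat.mod_mod, Nat.mod_eq_of_lt v.isLt]

end PinLoss

end TreeLike

/-- **Pin loss counts.** For every graph `G`, every `k`, every resolution refutation `π` of the unary `Clique(G,k)`
(dag-like, no hypothesis), and all `t, d`: writing `X(Q)` for the set of vertices of the `t`-clique `Q` whose pin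
variable occurs negatively in the clause of the last non-initial line of Delayer `Q`'s walk, the number of `t`-cliques
with `t ≤ |X(Q)| + d` (pin loss at most `d`) is at most `|π| · Σ_{e ≤ d} C(n, e)`. -/
theorem card_filter_pinLoss_le :
    ∀ {n k : ℕ} (G : SimpleGraph (Fin n)) [DecidableRel G.Adj] (π : List (ResLine ℕ))
      (hπ : IsResRefutation (cliqueCNF n k fun u v => decide (G.Adj u v)) π) (t d : ℕ),
      ∀ (r : ℕ) (hr : r < π.length), (π[r]'hr).clause = ∅ →
        ((G.cliqueFinset t).filter (fun Q => t ≤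
            (((π[TreeLike.lastLine n k π r Q]'(TreeLike.run_fst_lt _ hπ.1 hr _)).clause.filter
              (fun l => l.2 = false)).image (fun l => l.1 % n)).card + d)).card ≤
          π.length * (∑ e ∈ Finset.range (d + 1), n.choose e) := by
  intro n k G _ π hπ t d r hr hroot
  classical
  have hder := hπ.1
  -- abbreviations
  set X : Finset (Fin n) → Finset ℕ := fun Q =>
    (((π[TreeLike.lastLine n k π r Q]'(TreeLike.run_fst_lt _ hder hr _)).clause.filter
      fun l => l.2 = false).image fun l => l.1 % n) with hX
  set good := (G.cliqueFinset t).filter fun Q => t ≤ (X Q).card + d with hgood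
  -- target of the injection: (line, small subset of `range n`)
  set Tgt := (Finset.range π.length) ×ˢ
      ((Finset.range (d + 1)).biUnion fun e => (Finset.range n).powersetCard e) with hTgt
  have hTcard : Tgt.card ≤ π.length * (∑ e ∈ Finset.range (d + 1), n.choose e) := by
    rw [hTgt, Finset.card_product, Finset.card_range]
    refine Nat.mul_le_mul_left _ ?_
    refine (Finset.card_biUnion_le).trans ?_
    refine Finset.sum_le_sum fun e _ => ?_
    rw [Finset.card_powersetCard, Finset.card_range]
  refine le_trans ?_ hTcard
  refine Finset.card_le_card_of_injOn (fun Q => (TreeLike.lastLine n k π r Q, Q.image Fin.val \ X Q))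
    (fun Q hQ => ?_) ?_
  · -- lands in the target
    rw [Finset.mem_coe] at hQ
    obtain ⟨hQcl, hQgood⟩ := Finset.mem_filter.1 hQ
    have hQcard : Q.card = t := (SimpleGraph.mem_cliqueFinset_iff.1 hQcl).card_eq
    have hsub : X Q ⊆ Q.image Fin.val := TreeLike.decode_lastLine_subset G hder hr hroot Q
    rw [Finset.mem_coe, hTgt, Finset.mem_product]
    refine ⟨Finset.mem_range.2 (TreeLike.run_fst_lt _ hder hr _), ?_⟩
    rw [Finset.mem_biUnion]
    refine ⟨(Q.image Fin.val \ X Q).card, Finset.mem_range.2 ?_, ?_⟩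
    · have h1 : (Q.image Fin.val \ X Q).card = (Q.image Fin.val).card - (X Q).card :=
        Finset.card_sdiff_of_subset hsub
      have h2 : (Q.image Fin.val).card = t := by
        rw [Finset.card_image_of_injective _ Fin.val_injective, hQcard]
      omega
    · rw [Finset.mem_powersetCard]
      refine ⟨fun x hx => ?_, rfl⟩
      obtain ⟨hx, -⟩ := Finset.mem_sdiff.1 hx
      obtain ⟨v, -, rfl⟩ := Finset.mem_image.1 hx
      exact Finset.mem_range.2 v.isLt
  · -- injective: `Q.image val = X Q ∪ (Q.image val \\ X Q)` and `X Q` is determined by the line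
    intro Q hQ Q' hQ' heq
    obtain ⟨hline, hdiff⟩ := Prod.mk.injEq _ _ _ _ |>.mp heq
    have hsub : X Q ⊆ Q.image Fin.val := TreeLike.decode_lastLine_subset G hder hr hroot Q
    have hsub' : X Q' ⊆ Q'.image Fin.val := TreeLike.decode_lastLine_subset G hder hr hroot Q'
    have key : ∀ {a b : ℕ} (ha : a < π.length) (hb : b < π.length), a = b →
        ((π[a]'ha).clause.filter (fun l => l.2 = false)).image (fun l => l.1 % n) =
        ((π[b]'hb).clause.filter (fun l => l.2 = false)).image (fun l => l.1 % n) := by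
      intro a b ha hb hab; subst hab; rfl
    have hXX : X Q = X Q' := key _ _ hline
    have h1 : Q.image Fin.val = X Q ∪ (Q.image Fin.val \ X Q) := (Finset.union_sdiff_of_subset hsub).symm
    have h2 : Q'.image Fin.val = X Q' ∪ (Q'.image Fin.val \ X Q') := (Finset.union_sdiff_of_subset hsub').symm
    have : Q.image Fin.val = Q'.image Fin.val := by
      rw [h1, h2]
      rw [hXX] at hdiff ⊢
      rw [hdiff]
    exact Finset.image_injective Fin.val_injective this

end Summit.PneNP.PneNP.Theorems.RamseyUncertifiableResolutionUncertainty
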